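import Literature.AnabelianGeometry.EtaleTheta.Discharge.Sec1ZHatHeisenbergLevels
import Literature.AnabelianGeometry.AbsoluteAnabelian.ZHatCompletionFreeProcyclic
import Mathlib.Data.ZMod.Basic
import HarnessLib

/-!
# Plumbing for "`(Δ^tp_Y)^ell ≅ Ẑ(1)`" ([EtTh] §1 p. 13): continuous endomorphisms of `Ẑ = completion ℤ`
# act by multiplication at every finite level (proof-only, generic; no definition)

Mochizuki, *The étale theta function and its Frobenioid-theoretic manifestations*, Publ. RIMS **45**
(2009) [EtTh], §1, PRIMS PDF p. 13: "`1 → (Δ^tp_Y)^ell ⊗ ℤ/Nℤ → Gal(Y_N/Y) → Gal(K_N/K) → 1` …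
`(Δ^tp_Y)^ell ≅ Ẑ(1)`" [cite: MochizukiEtTh2009, §1 p.13]. Layer L2 of the abc-iut cell, seat abc-iut-w5-d024
(gen 3); generic lemmas used by `Discharge/Sec1FreeTwoKernelZHat.lean` (the pure-profinite core of the NV-L6
`CoreTower` input (ii), L2-lead RULINGS #3 R30) — a continuation of abc-iut-w5-d171's `ZHatLevels` plumbing
(`Sec1ZHatHeisenbergLevels.lean`).

The point of this file: the tree's `Ẑ` is Mathlib's `ProfiniteGrp.ProfiniteCompletion.completion` of
`Multiplicative ℤ` — a profinite GROUP with no ring structure. The `Ẑ`-linear algebra needed for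
"`Ker(Ẑ² ↠ Ẑ) ≅ Ẑ`" is done LEVELWISE: reading an element `t ∈ Ẑ` at the level `N = ⟨n⟩` through the
continuous projection `v_N : Ẑ → ℤ/⟨n⟩` (`exists_valHom`), a continuous endomorphism `A : Ẑ → Ẑ` with
`A(η 1) ≡ i` sends `t ≡ j` to `A t ≡ j·i` (`valHom_apply_of_continuous`, by density of `η(ℤ)` via
w5-d171's `apply_pow_eq_zpow`); hence any two continuous endomorphisms of `Ẑ` commute
(`apply_comm_of_continuous`), and equalities in `Ẑ` are checked level by level (`eq_of_forall_valHom`)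
as congruences of integers (`mk_ofAdd_eq_mk_ofAdd_iff`).
All folklore [cite: RibesZalesskii2010, Thm 2.7.1]. HONEST FRAMING: nothing here bears on [IUTchIII] Cor. 3.12.
-/

noncomputable section

namespace Literature.AnabelianGeometry.EtaleTheta

open Literature.AnabelianGeometry.AbsoluteAnabelian
open _root_.Topology
open CategoryTheory ProfiniteGrp ProfiniteGrp.ProfiniteCompletion

namespace ZHatLevels

/-- The level-`N` projection `Ẑ ↠ ℤ/N` as a CONTINUOUS monoid homomorphism (packaged existentially:
no definition is introduced). [cite: MochizukiEtTh2009, §1 p.13] -/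
theorem exists_valHom (N : FiniteIndexNormalSubgroup (Multiplicative ℤ)) :
    ∃ v : completion (GrpCat.of (Multiplicative ℤ)) →ₜ* (Multiplicative ℤ ⧸ N.toSubgroup),
      ∀ t, v t = t.val N := by
  haveI : DiscreteTopology ((diagram (GrpCat.of (Multiplicative ℤ))).obj N) := ⟨rfl⟩
  refine ⟨{ toFun := fun t => t.val N
            map_one' := rfl
            map_mul' := fun _ _ => rfl
            continuous_toFun := ZHatCompletion.continuous_val N }, fun _ => rfl⟩

/-- Every element of `Ẑ` has an integer representative at each level. [cite: MochizukiEtTh2009, §1 p.13] -/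
theorem exists_valHom_eq_mk {N : FiniteIndexNormalSubgroup (Multiplicative ℤ)}
    (v : completion (GrpCat.of (Multiplicative ℤ)) →ₜ* (Multiplicative ℤ ⧸ N.toSubgroup))
    (hv : ∀ t, v t = t.val N) (t : completion (GrpCat.of (Multiplicative ℤ))) :
    ∃ j : ℤ, v t = QuotientGroup.mk (Multiplicative.ofAdd j) := by
  obtain ⟨g, hg⟩ := QuotientGroup.mk_surjective (t.val N : Multiplicative ℤ ⧸ N.toSubgroup)
  exact ⟨Multiplicative.toAdd g, by rw [ofAdd_toAdd, hv]; exact hg.symm⟩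

/-- At the level `⟨n⟩ ≤ ℤ`, two integers have the same class iff they are congruent modulo `n`
(read in `ZMod n`). [cite: MochizukiEtTh2009, §1 p.13] -/
theorem mk_ofAdd_eq_mk_ofAdd_iff {N : Subgroup (Multiplicative ℤ)} {n : ℕ}
    (hN : N = Subgroup.zpowers (Multiplicative.ofAdd (n : ℤ))) (x y : ℤ) :
    (QuotientGroup.mk (Multiplicative.ofAdd x) : Multiplicative ℤ ⧸ N) =
      QuotientGroup.mk (Multiplicative.ofAdd y) ↔ (x : ZMod n) = (y : ZMod n) := by
  rw [QuotientGroup.eq, ← ofAdd_neg, ← ofAdd_add, hN, ofAdd_mem_zpowers_iff,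
    ZMod.intCast_eq_intCast_iff_dvd_sub]
  constructor
  · rintro h
    have : (n : ℤ) ∣ -x + y := h
    rwa [neg_add_eq_sub] at this
  · intro h
    show (n : ℤ) ∣ -x + y
    rwa [neg_add_eq_sub]

/-- Products of classes of integers at a level. [cite: MochizukiEtTh2009, §1 p.13] -/
theorem mk_ofAdd_mul_mk_ofAdd (N : Subgroup (Multiplicative ℤ)) (x y : ℤ) :
    (QuotientGroup.mk (Multiplicative.ofAdd x) : Multiplicative ℤ ⧸ N) *
      QuotientGroup.mk (Multiplicative.ofAdd y) = QuotientGroup.mk (Multiplicative.ofAdd (x + y)) := by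
  rw [← QuotientGroup.mk_mul, ← ofAdd_add]

/-- Inverses of classes of integers at a level. [cite: MochizukiEtTh2009, §1 p.13] -/
theorem mk_ofAdd_inv (N : Subgroup (Multiplicative ℤ)) (x : ℤ) :
    (QuotientGroup.mk (Multiplicative.ofAdd x) : Multiplicative ℤ ⧸ N)⁻¹ =
      QuotientGroup.mk (Multiplicative.ofAdd (-x)) := by
  rw [← QuotientGroup.mk_inv, ← ofAdd_neg]

/-- The class of `0` at a level is the identity. [cite: MochizukiEtTh2009, §1 p.13] -/
theorem mk_ofAdd_zero (N : Subgroup (Multiplicative ℤ)) :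
    (QuotientGroup.mk (Multiplicative.ofAdd (0 : ℤ)) : Multiplicative ℤ ⧸ N) = 1 := by
  rw [ofAdd_zero, QuotientGroup.mk_one]

/-- **Two elements of `Ẑ` agree iff they agree at every level**, read through the level projections.
[cite: MochizukiEtTh2009, §1 p.13] -/
theorem eq_of_forall_valHom {t t' : completion (GrpCat.of (Multiplicative ℤ))}
    (h : ∀ (N : FiniteIndexNormalSubgroup (Multiplicative ℤ))
      (v : completion (GrpCat.of (Multiplicative ℤ)) →ₜ* (Multiplicative ℤ ⧸ N.toSubgroup)),
      (∀ s, v s = s.val N) → v t = v t') : t = t' := by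
  refine Subtype.ext (funext fun N => ?_)
  obtain ⟨v, hv⟩ := exists_valHom N
  exact (hv t).symm.trans ((h N v hv).trans (hv t'))

/-- The level-`N` class of `η(1) ∈ Ẑ` is the class of `1`. [cite: MochizukiEtTh2009, §1 p.13] -/
theorem valHom_etaFn_one {N : FiniteIndexNormalSubgroup (Multiplicative ℤ)}
    (v : completion (GrpCat.of (Multiplicative ℤ)) →ₜ* (Multiplicative ℤ ⧸ N.toSubgroup))
    (hv : ∀ t, v t = t.val N) :
    v (etaFn (GrpCat.of (Multiplicative ℤ)) (Multiplicative.ofAdd (1 : ℤ))) =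
      QuotientGroup.mk (Multiplicative.ofAdd (1 : ℤ)) := hv _

/-- **Continuous endomorphisms of `Ẑ` act by multiplication, levelwise**: if `A : Ẑ → Ẑ` is a
continuous homomorphism with `A(η 1) ≡ i (mod n)` and `t ≡ j (mod n)`, then `A t ≡ j·i (mod n)` (density of
`η(ℤ)`, through `ZHatLevels.apply_pow_eq_zpow`). [cite: MochizukiEtTh2009, §1 p.13] -/
theorem valHom_apply_of_continuous (A : completion (GrpCat.of (Multiplicative ℤ)) →ₜ*
      completion (GrpCat.of (Multiplicative ℤ)))
    {N : FiniteIndexNormalSubgroup (Multiplicative ℤ)} {n : ℕ}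
    (hN : (N.toSubgroup : Subgroup (Multiplicative ℤ)) = Subgroup.zpowers (Multiplicative.ofAdd (n : ℤ)))
    (v : completion (GrpCat.of (Multiplicative ℤ)) →ₜ* (Multiplicative ℤ ⧸ N.toSubgroup))
    (hv : ∀ t, v t = t.val N) {i j : ℤ}
    (hi : v (A (etaFn (GrpCat.of (Multiplicative ℤ)) (Multiplicative.ofAdd (1 : ℤ)))) =
      QuotientGroup.mk (Multiplicative.ofAdd i))
    (t : completion (GrpCat.of (Multiplicative ℤ)))
    (hj : v t = QuotientGroup.mk (Multiplicative.ofAdd j)) :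
    v (A t) = QuotientGroup.mk (Multiplicative.ofAdd (j * i)) := by
  haveI : DiscreteTopology ((diagram (GrpCat.of (Multiplicative ℤ))).obj N) := ⟨rfl⟩
  have hzn : (QuotientGroup.mk (Multiplicative.ofAdd i) : Multiplicative ℤ ⧸ N.toSubgroup) ^ n = 1 := by
    rw [← QuotientGroup.mk_pow, ← ofAdd_nsmul, nsmul_eq_mul, ← QuotientGroup.mk_one,
      ← ofAdd_zero, mk_ofAdd_eq_mk_ofAdd_iff hN]
    simp
  have hpow : ∀ m : ℤ, v (A (etaFn (GrpCat.of (Multiplicative ℤ))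
      (Multiplicative.ofAdd m : Multiplicative ℤ))) =
      (QuotientGroup.mk (Multiplicative.ofAdd i) : Multiplicative ℤ ⧸ N.toSubgroup) ^ m := by
    intro m
    rw [ZHatCompletion.etaFn_ofAdd m, map_zpow, map_zpow]
    exact congrArg (· ^ m) hi
  have h := apply_pow_eq_zpow A v _ hzn N hN hpow t ((hv t).symm.trans hj)
  rw [h, ← QuotientGroup.mk_zpow, ← ofAdd_zsmul, smul_eq_mul]

/-- **Continuous endomorphisms of `Ẑ` commute** (both act by multiplication at every level).
[cite: MochizukiEtTh2009, §1 p.13] -/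
theorem apply_comm_of_continuous (A B : completion (GrpCat.of (Multiplicative ℤ)) →ₜ*
      completion (GrpCat.of (Multiplicative ℤ))) (r : completion (GrpCat.of (Multiplicative ℤ))) :
    A (B r) = B (A r) := by
  refine eq_of_forall_valHom fun N v hv => ?_
  obtain ⟨n, hn, hN⟩ := exists_eq_zpowers N.toSubgroup
  obtain ⟨i, hi⟩ := exists_valHom_eq_mk v hv (A (etaFn (GrpCat.of (Multiplicative ℤ))
    (Multiplicative.ofAdd (1 : ℤ))))
  obtain ⟨k, hk⟩ := exists_valHom_eq_mk v hv (B (etaFn (GrpCat.of (Multiplicative ℤ))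
    (Multiplicative.ofAdd (1 : ℤ))))
  obtain ⟨j, hj⟩ := exists_valHom_eq_mk v hv r
  rw [valHom_apply_of_continuous A hN v hv hi _ (valHom_apply_of_continuous B hN v hv hk r hj),
    valHom_apply_of_continuous B hN v hv hk _ (valHom_apply_of_continuous A hN v hv hi r hj),
    mul_right_comm]

end ZHatLevels

end Literature.AnabelianGeometry.EtaleTheta

end
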